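import Summits.Ventures.PackingBounds.ThreePointCert.CheckKSM
import Summits.Ventures.PackingBounds.ThreePointCert.CheckIdKSSound

/-!
# Multi-point Kronecker check of the identity `(ii')` — kernel programs (layout ks5, identities)

Framing: lottery ticket; floor = certified bounds/negative ranges. Venture `PackingBounds`
(cell `pub-packcert`), three-point SDP family — kernel-checking infrastructure (lp gen 12).

`CheckIdKS.idCheckII w D c P ρ` decides the identity `(ii')` — `target − rhs − c₀ − ρ = 0` with
the residual `ρ` as data — by ONE evaluation at the Kronecker point `(2^w, 2^{wD}, 2^{wD²})`.
Those numbers have `w·D³` bits (≈ 1.6 MB at three-point degree 16, `D = 33`) and the kernel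
retains one or two of them per term of the expansions `E₀ … E₄` (≈ 1.4·10⁵ terms at degree 16):
beyond the gate's elaboration nodes (the `K13d16CheckId` file of the ks5 pilot is killed there;
at degree 14 the same program needs ≈ 220 s and passes).

The programs here decide the SAME boolean from `D + 1` small checks, as `CheckKSM` does for the
Gram units: the static check `idIIStatic` (the side conditions of `idCheckII` plus the width
bound `2·Σ|coeff|·D^D < 2^{wm}`) and, for each `τ < D`, the value check `idIIAtF wm D τ` of the
identity polynomial `qII c P ρ` at `(2^{wm}, 2^{wm·D}, τ)` — numbers of `wm·D²` bits, `Nat`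
arithmetic only:
* the expansions are read DIRECTLY from the rows' flat `List ℤ` leaves `[a, b, c, coeff, …]`
  (`evF` / `evFs` over the chunk lists; decoding them through `ofFlat` costs ≈ 1.3 ms and
  kilobytes of kernel cache per term) with a GROUPED three-level accumulation (the leaves are
  `(a, b, c)`-sorted: a run of equal `(a, b)` accumulates `Σ coeff·x_c^c` in a small number, each
  run is placed once with `x_b^b`, each `a`-block once with `x_a^a`), so the large numbers are
  touched once per run, not once per term;
* the small multipliers `g_q, m₂, m₃, p₄` go through the term-list evaluator `ev3` (same grouping);
* the six products multiplier × expansion are products of VALUES; the permuted copies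
  `g_q(πx)·E₁(πx)` of the symmetrised term are evaluations at `(2^{wD}, 2^w, τ)`, `(τ, 2^{wD}, 2^w)`.
Meaning and soundness (`idCheckII_of_pointsF : … → idCheckII w D c P ρ = true`, through
`CheckKSM.eval_eq_zero_of_kronecker_points` and `CheckIdKS.valII_eq`) are in `CheckIdKSMSound`.
No statement about certificates changes: a row keeps `theorem cert_idII : idCheckII w D cert polys
rhoII = true`, now PROVED from `D` point theorems, and `card_le_of_cert3KS` consumes it unchanged.
(`idCheckI` — the identity `(i')`, univariate data — is cheap at every degree and stays as it is.)
-/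

noncomputable section

namespace Summit.Ventures.PackingBounds.ThreePointCert

open Literature.Geometry.DiscreteGeometry Literature.Geometry.DiscreteGeometry.PolyCert
open Literature.Geometry.DiscreteGeometry.PolyCert.SPoly

/-! ### Kernel programs (`Nat` arithmetic only) -/

/-- Positive part of an integer coefficient. -/
def zpos (z : ℤ) : ℕ := Int.rec (motive := fun _ => ℕ) (fun n => n) (fun _ => 0) z

/-- Negative part of an integer coefficient. -/
def zneg (z : ℤ) : ℕ := Int.rec (motive := fun _ => ℕ) (fun _ => 0) (fun n => Nat.succ n) z

/-- **Grouped three-level evaluation** of one sign part of a term list at `(x_a, x_b, x_c) ∈ ℕ³`: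
state `(ka, kb, c, b, a)` = current run key and the three accumulators; a term with the current
key `(ka, kb)` adds `part·x_c^c` to `c`; a new `b` flushes `c·x_b^kb` into `b`; a new `a` flushes
`(b + c·x_b^kb)·x_a^ka` into `a`. `part` selects the sign part of the coefficient. -/
def ev3 (part : ℤ → ℕ) (xa xb xc : ℕ) (p : SPoly) : ℕ → ℕ → ℕ → ℕ → ℕ → ℕ :=
  p.rec (motive := fun _ => ℕ → ℕ → ℕ → ℕ → ℕ → ℕ)
    (fun ka kb c b a => Nat.add a (Nat.mul (Nat.add b (Nat.mul c (Nat.pow xb kb))) (Nat.pow xa ka)))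
    (fun mc _ ih ka kb c b a =>
      Bool.rec (motive := fun _ => ℕ)
        (ih mc.1.a mc.1.b (Nat.mul (part mc.2) (Nat.pow xc mc.1.c)) 0
          (Nat.add a (Nat.mul (Nat.add b (Nat.mul c (Nat.pow xb kb))) (Nat.pow xa ka))))
        (Bool.rec (motive := fun _ => ℕ)
          (ih ka mc.1.b (Nat.mul (part mc.2) (Nat.pow xc mc.1.c)) (Nat.add b (Nat.mul c (Nat.pow xb kb))) a)
          (ih ka kb (Nat.add c (Nat.mul (part mc.2) (Nat.pow xc mc.1.c))) b a)
          (Nat.beq mc.1.b kb))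
        (Nat.beq mc.1.a ka))

/-- Positive part of the value of `p` at `(x_a, x_b, x_c)`. -/
def evP (xa xb xc : ℕ) (p : SPoly) : ℕ := ev3 zpos xa xb xc p 0 0 0 0 0

/-- Negative part of the value of `p` at `(x_a, x_b, x_c)`. -/
def evN (xa xb xc : ℕ) (p : SPoly) : ℕ := ev3 zneg xa xb xc p 0 0 0 0 0

/-- Both parts of the value of `p` at `(x_a, x_b, x_c)`, forced, then the continuation. -/
def withEv {α : Type} (xa xb xc : ℕ) (p : SPoly) (k : ℕ → ℕ → α) : α :=
  forceNat (evP xa xb xc p) fun P => forceNat (evN xa xb xc p) fun N => k P N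

/-- Positive part `P_p·P_q + N_p·N_q` of the product of two values given by their parts. -/
def mulPP (pP pN qP qN : ℕ) : ℕ := Nat.add (Nat.mul pP qP) (Nat.mul pN qN)

/-- Negative part `P_p·N_q + N_p·P_q` of the product of two values given by their parts. -/
def mulPN (pP pN qP qN : ℕ) : ℕ := Nat.add (Nat.mul pP qN) (Nat.mul pN qP)

/-! ### Flat-leaf programs: the expansions are read directly from the `List ℤ` leaves

The row files define each expansion as `ofFlat f₀ ++ ofFlat f₁ ++ …` (then `smul c`); decoding
that in the kernel costs ≈ 1.3 ms and several KB of retained cache per term (degree 16: `E₀` alone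
55 s; ≈ 9·10⁴ decoded terms exhaust an elaboration node). The programs below read the flat lists
`[a, b, c, coeff, a, b, c, coeff, …]` themselves (four cells per term, a phase counter `i`) with the
same grouped three-level accumulation as `ev3`; a row file supplies the chunk lists
`[f₀, f₁, …] : List (List ℤ)` and the (syntactic) equations `P.E_k = smul c_k (polyOfChunks …)`. -/

/-- Exponent cell as a natural (`Int.toNat`, by recursion). -/
def znat (z : ℤ) : ℕ := Int.rec (motive := fun _ => ℕ) (fun n => n) (fun _ => 0) z

/-- The term list encoded by a list of flat chunks: `ofFlat f₀ ++ ofFlat f₁ ++ ⋯`. -/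
def polyOfChunks (ls : List (List ℤ)) : SPoly := ls.foldr (fun l acc => ofFlat l ++ acc) []

/-- **Grouped evaluation of ONE flat chunk** (one sign part) at `(x_a, x_b, x_c)`: `i` = cells of the
current term read so far, `ta tb tc` = its exponents, then the `ev3` state `(ka, kb, c, b, a)`; the
final state is handed to the continuation `k` (the next chunk). -/
def evF (part : ℤ → ℕ) (xa xb xc : ℕ) (l : List ℤ) :
    ℕ → ℕ → ℕ → ℕ → ℕ → ℕ → ℕ → ℕ → ℕ → (ℕ → ℕ → ℕ → ℕ → ℕ → ℕ) → ℕ :=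
  l.rec (motive := fun _ => ℕ → ℕ → ℕ → ℕ → ℕ → ℕ → ℕ → ℕ → ℕ → (ℕ → ℕ → ℕ → ℕ → ℕ → ℕ) → ℕ)
    (fun _ _ _ _ ka kb c b a k => k ka kb c b a)
    (fun z _ ih i ta tb tc ka kb c b a k =>
      Nat.rec (motive := fun _ => ℕ)
        (ih 1 (znat z) tb tc ka kb c b a k)
        (fun i1 _ => Nat.rec (motive := fun _ => ℕ)
          (ih 2 ta (znat z) tc ka kb c b a k)
          (fun i2 _ => Nat.rec (motive := fun _ => ℕ)
            (ih 3 ta tb (znat z) ka kb c b a k)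
            (fun _ _ =>
              Bool.rec (motive := fun _ => ℕ)
                (ih 0 0 0 0 ta tb (Nat.mul (part z) (Nat.pow xc tc)) 0
                  (Nat.add a (Nat.mul (Nat.add b (Nat.mul c (Nat.pow xb kb))) (Nat.pow xa ka))) k)
                (Bool.rec (motive := fun _ => ℕ)
                  (ih 0 0 0 0 ka tb (Nat.mul (part z) (Nat.pow xc tc)) (Nat.add b (Nat.mul c (Nat.pow xb kb))) a k)
                  (ih 0 0 0 0 ka kb (Nat.add c (Nat.mul (part z) (Nat.pow xc tc))) b a k)
                  (Nat.beq tb kb))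
                (Nat.beq ta ka))
            i2) i1) i)

/-- Grouped evaluation (one sign part) of a list of flat chunks, threading the state; final flush. -/
def evFs (part : ℤ → ℕ) (xa xb xc : ℕ) (ls : List (List ℤ)) : ℕ → ℕ → ℕ → ℕ → ℕ → ℕ :=
  ls.rec (motive := fun _ => ℕ → ℕ → ℕ → ℕ → ℕ → ℕ)
    (fun ka kb c b a => Nat.add a (Nat.mul (Nat.add b (Nat.mul c (Nat.pow xb kb))) (Nat.pow xa ka)))
    (fun l _ ih ka kb c b a => evF part xa xb xc l 0 0 0 0 ka kb c b a ih)

/-- Positive part of the value of `polyOfChunks ls` at `(x_a, x_b, x_c)`. -/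
def evFP (xa xb xc : ℕ) (ls : List (List ℤ)) : ℕ := evFs zpos xa xb xc ls 0 0 0 0 0

/-- Negative part of the value of `polyOfChunks ls` at `(x_a, x_b, x_c)`. -/
def evFN (xa xb xc : ℕ) (ls : List (List ℤ)) : ℕ := evFs zneg xa xb xc ls 0 0 0 0 0

/-- Both parts of the value of `polyOfChunks ls`, forced, then the continuation. -/
def withEvF {α : Type} (xa xb xc : ℕ) (ls : List (List ℤ)) (k : ℕ → ℕ → α) : α :=
  forceNat (evFP xa xb xc ls) fun P => forceNat (evFN xa xb xc ls) fun N => k P N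

/-- **The value check of `(ii')` at one point, flat data**: as `idIIAt`, with `FP, E₀…E₄, ρ` given
by chunk lists and the scales `s_k` of `E_k = s_k • polyOfChunks E_kc` applied to the values. -/
def idIIAtF (w D τ : ℕ) (c : Cert3) (FPc E0c E1c E2c E3c E4c ρc : List (List ℤ))
    (s0 s1 s2 s3 s4 : ℕ) : Bool :=
  let X := Nat.pow 2 w
  let Y := Nat.pow 2 (Nat.mul w D)
  withEvF X Y τ FPc fun fP fN =>
  withEvF X Y τ E0c fun aP aN =>
  withEvF X Y τ ρc fun rP rN =>
  withEv X Y τ (gqU c.p c.q) fun gP gN =>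
  withEvF X Y τ E1c fun bP bN =>
  withEv Y X τ (gqU c.p c.q) fun hP hN =>
  withEvF Y X τ E1c fun iP iN =>
  withEv τ Y X (gqU c.p c.q) fun jP jN =>
  withEvF τ Y X E1c fun kP kN =>
  withEv X Y τ (m2G c.p c.q) fun lP lN =>
  withEvF X Y τ E2c fun mP mN =>
  withEv X Y τ (m3G c.p c.q) fun oP oN =>
  withEvF X Y τ E3c fun sP sN =>
  withEv X Y τ p4 fun xP xN =>
  withEvF X Y τ E4c fun yP yN =>
    Nat.beq
      (Nat.add (Nat.add (Nat.add (Nat.add (Nat.add (Nat.add (Nat.add (Nat.add (Nat.add (Nat.add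
        c.B22 c.c0) fP) (Nat.mul s0 aP)) rP) (mulPP gP gN (Nat.mul s1 bP) (Nat.mul s1 bN)))
        (mulPP hP hN (Nat.mul s1 iP) (Nat.mul s1 iN))) (mulPP jP jN (Nat.mul s1 kP) (Nat.mul s1 kN)))
        (mulPP lP lN (Nat.mul s2 mP) (Nat.mul s2 mN))) (mulPP oP oN (Nat.mul s3 sP) (Nat.mul s3 sN)))
        (mulPP xP xN (Nat.mul s4 yP) (Nat.mul s4 yN)))
      (Nat.add (Nat.add (Nat.add (Nat.add (Nat.add (Nat.add (Nat.add (Nat.add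
        fN (Nat.mul s0 aN)) rN) (mulPN gP gN (Nat.mul s1 bP) (Nat.mul s1 bN)))
        (mulPN hP hN (Nat.mul s1 iP) (Nat.mul s1 iN))) (mulPN jP jN (Nat.mul s1 kP) (Nat.mul s1 kN)))
        (mulPN lP lN (Nat.mul s2 mP) (Nat.mul s2 mN))) (mulPN oP oN (Nat.mul s3 sP) (Nat.mul s3 sN)))
        (mulPN xP xN (Nat.mul s4 yP) (Nat.mul s4 yN)))

/-- **Static side conditions** (checked once): exactly the side conditions of `idCheckII w D`
(exponent boxes, `Σ|ρ| ≤ c₀`, the single-point width bound `2·bndII < 2^w`) plus the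
multi-point width bound `2·bndII·D^D < 2^{wm}` for the `D` evaluation points `τ < D`. -/
def idIIStatic (w wm D : ℕ) (c : Cert3) (P : CertPolys3) (ρ : SPoly) : Bool :=
  decide (2 ≤ D) && boxOK D P.FP && boxOK D P.E0 && boxOK (D - 2) P.E1 && boxOK (D - 2) P.E2 &&
    boxOK (D - 2) P.E3 && boxOK (D - 2) P.E4 && boxOK D ρ && decide (absSum ρ ≤ c.c0) &&
    decide (2 * bndII c P ρ < 2 ^ w) && decide (2 * (bndII c P ρ * D ^ D) < 2 ^ wm)

end Summit.Ventures.PackingBounds.ThreePointCert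

end
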